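import Literature.Computability.MetaComplexity.GapMINKTNWSampler
import Literature.Computability.MetaComplexity.GapMINKTNWBruteForce
import Literature.Computability.MetaComplexity.GapMINKTDenseRandomProofs
import Literature.Computability.MetaComplexity.GapMINKTDenseRandomAvgPProofs
import Literature.Computability.MetaComplexity.AvgCaseDerandomization
import Literature.Computability.MetaComplexity.UHSParameters
import Literature.Computability.Complexity.StringCopy
import HarnessLib

/-!
# Hirahara's Cor. 4.23 from Buhrman–Fortnow–Pavan and a polynomial-time list-decodable code

Topic `Literature/Computability/MetaComplexity`, proof file for the named fact
`Hirahara2018_gapMINKT_mem_PromiseP` (`GapMINKT.lean`): S. Hirahara, *Non-black-box worst-case to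
average-case reductions within NP*, FOCS 2018 / ECCC TR18-138, **Cor. 4.23** — *if `DistNP ⊆ AvgP` then
`Gap_{σ,τ}MINKT ∈ Promise-P` for some `σ(n, s) = s + O((log n)√s + (log n)²)` and polynomial `τ`.*

The printed proof is "[BFP05] showed that `DistNP ⊆ AvgP` implies … `Promise-BPP = Promise-P`. Cor. 4.23
immediately follows by combining their result with Cor. 4.22", and Cor. 4.22 is Lemma 4.17 (a dense
subset of random strings in `P`, PROVED in the tree: `Hirahara2018_dense_randomStrings_of_AvgDeltaP_holds`,
`Hirahara2018_MINKTr_DKT_mem_AvgDeltaP_holds`) followed by Thm. 4.21, whose proof (§4.1) runs the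
Nisan–Wigderson generator on a list-decodable encoding of `x` against that dense set: Lemma 4.4
(designs), Lemma 4.6 (reconstruction), Thm. 4.7 (a polynomial-time list-decodable code, cited from
[Sud97, STV01]), Cor. 4.8–Lemma 4.10, Thm. 4.11 / Cor. 4.12 (parameters), Lemma 4.19 (budgets rounded to
powers of two), Lemma 4.20 / Fact 3.8 (zero-error search ⇒ `Promise-ZPP`). This file proves Cor. 4.23 from

* the tree's named fact `BuhrmanFortnowPavan2004_PromiseBPP'_subset_PromiseP` (BFP, Thm. 3.1), and
* **Thm. 4.7 as an explicit hypothesis** `hcode` (a binary code of length `2^ℓ = poly(n/ε)` computable in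
  polynomial time and list-decodable in polynomial time from agreement `1/2 + ε`, the list read by `nthF`),

through the DECISION version of §4.1 (no search version, no zero-error conversion): on `⟨x, 1ᵗ, 1ˢ⟩`,
with `s` known the parameters of Cor. 4.12 are fixed directly (`d/ℓ ≈ √s`, `m = s + d + O(log n)`), the
promise problem "no NW output hits the dense set `T_{t₁}`" vs "the outputs hit it with probability `≥ 1/6`"
is in `Promise-BPP` (seven samples, `GapMINKTNWSampler.lean`), hence in `Promise-P` by BFP; yes-instances
land on the first side by Lemma 4.10 (`GapMINKTNWOutputs.lean`), no-instances on the second side by the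
reconstruction (Lemma 4.6/4.9 in `K`-form, `GapMINKTNWRecon.lean`, with the design of lines
`LineDesigns.lean` in the role of Lemma 4.4 and the double ruler `KtDoubleRuler.lean` in the role of
Lemma 4.19); the regime `t ≥ 2^{|x|}` is decided by exhaustive search (`GapMINKTNWBruteForce.lean`, as in
the proofs of Cor. 4.12 and Thm. 4.21), and short `x` / large `s` are yes-trivial.

* `GapNW.Setup` — the data of the proof (machine, dense language, code, constants) and its derived
  parameters (`cfg`, thresholds, `σ`, `τ`); the arithmetic of Cor. 4.12's parameter choice;
* `GapNW.Setup.yes_avoid`, `GapNW.Setup₂.no_hits` — the two sides; `GapNW.Setup₂.gapMINKT_mem_PromiseP`;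
* **`Hirahara2018_gapMINKT_mem_PromiseP_of_code`** — Cor. 4.23 from BFP and Thm. 4.7.

## References

* S. Hirahara, ECCC TR18-138 (2018), §4.1 (Lemma 4.4–Cor. 4.12), Lemma 4.17, Lemma 4.19, Thm. 4.21,
  Cor. 4.22, Cor. 4.23 (pp. 14–24); Thm. 4.7 ([Sud97], [STV01], [Vad12, Problem 5.2]).
* H. Buhrman, L. Fortnow, A. Pavan, *Some results on derandomization*, Theory Comput. Syst. 38 (2005), Thm. 3.1.
* M. Sudan, *Decoding of Reed Solomon codes beyond the error-correction bound*, J. Complexity 13 (1997);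
  M. Sudan, L. Trevisan, S. Vadhan, *Pseudorandom generators without the XOR lemma*, JCSS 62 (2001).
-/

noncomputable section

namespace Literature.Computability.MetaComplexity

open _root_.Computability Polynomial Complexity Complexity.Brick Complexity.Plumb Complexity.OracleCompose Complexity.HashBricks Filter

namespace GapNW

/-! ### The data of the proof -/

/-- **The data of the proof of Cor. 4.23**: the universal machine, the dense language of random strings
(Lemma 4.17), the list-decodable code (Thm. 4.7), the printing constant (`K^{p_P(n)}(x) ≤ n + c_P`), the
constants of Lemma 4.10, and a power bound for the list-size polynomial. [cite: Hirahara2018, Thm. 4.21 (proof)] -/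
structure Setup where
  /-- The efficient universal machine. -/
  U : UniversalMachine
  /-- The dense language `T ∈ P` of Lemma 4.17. -/
  TL : Language Bool
  hTL : TL ∈ Classes.P
  /-- The threshold of Lemma 4.17. -/
  n₀ : ℕ
  hT : ∀ m' ≥ n₀, ∀ t' : ℕ, {y : List Bool | y.length = m' ∧ paramEnc (y, t') ∈ TL} ⊆ U.randomStrings t' (fun n => n - 1) ∧
    IsDense m' (1 / 3) {y | paramEnc (y, t') ∈ TL}
  /-- The code: encoder, decoder, block length, length constant, list-size polynomial. -/
  enc : List Bool → List Bool
  dec : List Bool → List Bool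
  ell : ℕ → ℕ → ℕ
  cL : ℕ
  pL : Polynomial ℕ
  henc : enc ∈ FP
  hdec : dec ∈ FP
  hell : ∀ n e, ell n e ≤ cL * (Nat.log 2 (n + e) + 1)
  hlen : ∀ (n e : ℕ) (x : List Bool), x.length = n → (enc (boolPair (ones e) x)).length = 2 ^ ell n e
  hdecode : ∀ (n e : ℕ) (x r : List Bool), x.length = n → 1 ≤ e → r.length = 2 ^ ell n e →
    (e + 2) * 2 ^ ell n e ≤ 2 * e * NWStr.agreeCount r (enc (boolPair (ones e) x)) →
    ∃ i ≤ pL.eval (n + e), nthF i (dec (boolPair (ones e) (boolPair (ones n) r))) = x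
  /-- The power bound of the list-size polynomial: `pL(k) + 2 ≤ (k+2)^{2^{eL}}`. -/
  eL : ℕ
  heL : ∀ k, pL.eval k + 2 ≤ (k + 2) ^ (2 ^ eL)
  /-- The printing constant and budget: `K^{pP(n)}(x) ≤ n + cP` for every `x` of length `n`. -/
  cP : ℕ
  pP : Polynomial ℕ
  hprint : ∀ x : List Bool, U.ktAt (pP.eval x.length) x ≤ x.length + cP
  /-- The constants of Lemma 4.10 for `U` and `enc`. -/
  cY : ℕ
  qY : Polynomial ℕ
  hY : ∀ (u d₀ x z : List Bool) (e ℓ q m t : ℕ),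
    U.run d₀ t = some x → t ≤ NWOut.rulerLen u → e ≤ NWOut.rulerLen u → ℓ ≤ NWOut.rulerLen u → q ≤ NWOut.rulerLen u →
    m ≤ NWOut.rulerLen u → d₀.length ≤ NWOut.rulerLen u →
    U.ktAt (qY.eval (2 ^ (expPad 1 u).length + (NWOut.payloadY e ℓ q m d₀ z).length))
        (NWStr.nwOut q (enc (boolPair (ones e) x)) (LineDesign.lineDesign q ℓ m) z) ≤
      (NWOut.payloadY e ℓ q m d₀ z).length + 2 * u.length + cY

namespace Setup

variable (S : Setup)

/-- The exponent of the domination polynomial: `D = 16 cL + 4·2^{eL} + 16`. [folklore] -/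
def D : ℕ := 16 * S.cL + 4 * 2 ^ S.eL + 16
/-- The slack constant `A = 54 D + 46`. [folklore] -/
def A : ℕ := 54 * S.D + 46
/-- The slack constant `B = cY + 54 D + 48 + n₀`. [folklore] -/
def B : ℕ := S.cY + 54 * S.D + 48 + S.n₀

/-- **The configuration of the procedure**: `e = (n+2)³`, slack `A (log₂ n + 1) + B`, `V = t + (n+2)^D`,
ruler room `8(2V+2)²(4V+6)`, `t₁ = qY(T + (n+2)^{D+1})`. [cite: Hirahara2018, Cor. 4.12 (proof), Thm. 4.21 (proof)] -/
def cfg : NWPar.Cfg where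
  enc := S.enc
  Pe := (X + 2) ^ 3
  A := S.A
  B := S.B
  Nbig := (X + 2) ^ S.D
  Rpoly := 8 * (2 * X + 2) ^ 2 * (4 * X + 6)
  qY := S.qY
  PY := (X + 2) ^ (S.D + 1)

/-- The ruler always has room: `T ≤ Rpoly(V)`. [folklore] -/
theorem hR (n t : ℕ) : S.cfg.TOf n t ≤ S.cfg.Rpoly.eval (S.cfg.VOf n t) := by
  have := S.cfg.TOf_le n t
  simp only [cfg, eval_mul, eval_pow, eval_add, eval_X, eval_ofNat] at this ⊢
  exact this

/-! ### The parameters of the instance -/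

section Params

variable (x : List Bool) (t s : ℕ)

/-- `e = (n+2)³`. [folklore] -/
theorem eOf_eq (n : ℕ) : S.cfg.eOf n = (n + 2) ^ 3 := by simp [NWPar.Cfg.eOf, cfg]

/-- `1 ≤ e`. [folklore] -/
theorem one_le_eOf (n : ℕ) : 1 ≤ S.cfg.eOf n := by rw [eOf_eq]; exact Nat.one_le_pow _ _ (by omega)

/-- `|f| = 2^{ell n e}`. [folklore] -/
theorem length_fOf : (S.cfg.fOf x).length = 2 ^ S.ell x.length (S.cfg.eOf x.length) := by
  rw [NWPar.Cfg.fOf]; exact S.hlen _ _ x rfl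

/-- **`ℓ = ell n e`** (the machine reads `ℓ` off the length of the code word). [cite: Hirahara2018, Lemma 4.9 ("`2^ℓ := |Enc_{n,δ}(x)|`")] -/
theorem ellOf_eq : S.cfg.ellOf x = S.ell x.length (S.cfg.eOf x.length) := by
  rw [NWPar.Cfg.ellOf, length_fOf, Nat.log_pow (by norm_num)]

/-- `R(n) = A(log₂ n + 1) + B`. [folklore] -/
theorem ROf_eq (n : ℕ) : S.cfg.ROf n = S.A * (Nat.log 2 n + 1) + S.B := rfl

/-- `log₂ (n + 2) ≤ log₂ n + 1` for `n ≥ 2`. [folklore] -/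
theorem log_add_two_le {n : ℕ} (hn : 2 ≤ n) : Nat.log 2 (n + 2) ≤ Nat.log 2 n + 1 := by
  calc Nat.log 2 (n + 2) ≤ Nat.log 2 (n * 2) := Nat.log_mono_right (by omega)
    _ = Nat.log 2 n + 1 := Nat.log_mul_base one_lt_two (by omega)

/-- `log₂ (k^a) + 1 ≤ a (log₂ k + 1)` for `k ≥ 1`, `a ≥ 1`. [folklore] -/
theorem log_pow_succ_le {k a : ℕ} (hk : 1 ≤ k) (ha : 1 ≤ a) : Nat.log 2 (k ^ a) + 1 ≤ a * (Nat.log 2 k + 1) := by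
  have h1 : k < 2 ^ (Nat.log 2 k + 1) := Nat.lt_pow_succ_log_self one_lt_two k
  have h2 : k ^ a < 2 ^ (a * (Nat.log 2 k + 1)) := by
    rw [pow_mul']; exact Nat.pow_lt_pow_left h1 (by omega)
  have h3 : Nat.log 2 (k ^ a) < a * (Nat.log 2 k + 1) := Nat.log_lt_of_lt_pow (by positivity) h2
  omega

/-- `n + (n+2)³ ≤ (n+2)⁴`. [folklore] -/
theorem add_cube_le_pow_four (n : ℕ) : n + (n + 2) ^ 3 ≤ (n + 2) ^ 4 := by
  have h : n ≤ (n + 2) ^ 3 := (Nat.le_add_right n 2).trans (Nat.le_self_pow (by norm_num) _)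
  calc n + (n + 2) ^ 3 ≤ (n + 2) ^ 3 + (n + 2) ^ 3 := Nat.add_le_add_right h _
    _ = 2 * (n + 2) ^ 3 := by ring
    _ ≤ (n + 2) * (n + 2) ^ 3 := Nat.mul_le_mul_right _ (by omega)
    _ = (n + 2) ^ 4 := by ring

/-- **`ℓ ≤ 4 cL (log₂ n + 2)`** for `n ≥ 2` (Thm. 4.7: `ℓ = O(log(n/ε))` with `ε⁻¹ = (n+2)³`). [cite: Hirahara2018, Thm. 4.7] -/
theorem ellOf_le (hn : 2 ≤ x.length) : S.cfg.ellOf x ≤ 4 * S.cL * (Nat.log 2 x.length + 2) := by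
  rw [ellOf_eq, eOf_eq]
  set n := x.length
  refine (S.hell n _).trans ?_
  have h2 : Nat.log 2 (n + (n + 2) ^ 3) + 1 ≤ 4 * (Nat.log 2 (n + 2) + 1) :=
    (Nat.succ_le_succ (Nat.log_mono_right (add_cube_le_pow_four n))).trans (log_pow_succ_le (by omega) (by norm_num))
  have h3 := log_add_two_le hn
  calc S.cL * (Nat.log 2 (n + (n + 2) ^ 3) + 1) ≤ S.cL * (4 * (Nat.log 2 (n + 2) + 1)) := Nat.mul_le_mul_left _ h2
    _ ≤ S.cL * (4 * (Nat.log 2 n + 2)) := Nat.mul_le_mul_left _ (by omega)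
    _ = 4 * S.cL * (Nat.log 2 n + 2) := by ring

/-- **`2^ℓ ≤ (n+2)^{8 cL}`** for `n ≥ 2`. [cite: Hirahara2018, Thm. 4.7 (`2^ℓ = poly(n/ε)`)] -/
theorem two_pow_ellOf_le (hn : 2 ≤ x.length) : 2 ^ S.cfg.ellOf x ≤ (x.length + 2) ^ (8 * S.cL) := by
  rw [ellOf_eq, eOf_eq]
  set n := x.length
  have h2 : Nat.log 2 (n + (n + 2) ^ 3) + 1 ≤ 4 * (Nat.log 2 (n + 2) + 1) :=
    (Nat.succ_le_succ (Nat.log_mono_right (add_cube_le_pow_four n))).trans (log_pow_succ_le (by omega) (by norm_num))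
  have h3 : 2 ^ (Nat.log 2 (n + 2) + 1) ≤ 2 * (n + 2) := by
    rw [pow_succ, mul_comm]; exact Nat.mul_le_mul_left 2 (Nat.pow_log_le_self 2 (by omega))
  calc 2 ^ S.ell n ((n + 2) ^ 3) ≤ 2 ^ (S.cL * (Nat.log 2 (n + (n + 2) ^ 3) + 1)) := Nat.pow_le_pow_right (by norm_num) (S.hell n _)
    _ ≤ 2 ^ (S.cL * (4 * (Nat.log 2 (n + 2) + 1))) := Nat.pow_le_pow_right (by norm_num) (Nat.mul_le_mul_left _ h2)
    _ = (2 ^ (Nat.log 2 (n + 2) + 1)) ^ (4 * S.cL) := by rw [← pow_mul]; ring_nf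
    _ ≤ (2 * (n + 2)) ^ (4 * S.cL) := Nat.pow_le_pow_left h3 _
    _ ≤ ((n + 2) ^ 2) ^ (4 * S.cL) := Nat.pow_le_pow_left (by nlinarith) _
    _ = (n + 2) ^ (8 * S.cL) := by rw [← pow_mul]; ring_nf

/-- **The prime of the design**: `N_q ≤ q`, `q` prime, `q ≤ 2 N_q + 2`. [cite: NisanWigderson1994, Lemma 2.5] -/
theorem qOf_spec : S.cfg.NqOf x s ≤ S.cfg.qOf x s ∧ (S.cfg.qOf x s).Prime ∧ S.cfg.qOf x s ≤ 2 * S.cfg.NqOf x s + 2 :=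
  ⟨(leastPrimeGe_spec _).1, (leastPrimeGe_spec _).2, NWPar.leastPrimeGe_le_two_mul_add_two _⟩

/-- `N_q = 2ℓ + 2⌊√s⌋ + R`. [folklore] -/
theorem NqOf_eq : S.cfg.NqOf x s = 2 * S.cfg.ellOf x + 2 * Nat.sqrt s + S.cfg.ROf x.length := rfl

/-- `m = s + ℓ q + R`. [folklore] -/
theorem mOf_eq : S.cfg.mOf x s = s + S.cfg.ellOf x * S.cfg.qOf x s + S.cfg.ROf x.length := rfl

/-- `d = ℓ q`. [folklore] -/
theorem dOf_eq : S.cfg.dOf x s = S.cfg.ellOf x * S.cfg.qOf x s := rfl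

/-- `ℓ ≤ q`. [folklore] -/
theorem ellOf_le_qOf : S.cfg.ellOf x ≤ S.cfg.qOf x s := by
  have := (S.qOf_spec x s).1; rw [NqOf_eq] at this; omega

/-- `48 ≤ B ≤ R`. [folklore] -/
theorem B_le_ROf (n : ℕ) : S.B ≤ S.cfg.ROf n := by rw [ROf_eq]; exact Nat.le_add_left _ _

/-- The constant `B` dominates `cY + 48 + n₀`. [folklore] -/
theorem le_B : S.cY + 48 + S.n₀ ≤ S.B := by unfold B; omega

/-- `s ≤ ⌊√s⌋ · q` (as `q ≥ ⌊√s⌋ + 3`). [folklore] -/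
theorem le_sqrt_mul_qOf : s ≤ Nat.sqrt s * S.cfg.qOf x s := by
  have hq := (S.qOf_spec x s).1
  rw [NqOf_eq] at hq
  have hB := S.B_le_ROf x.length
  have h48 := S.le_B
  have hs := Nat.lt_succ_sqrt s
  have : Nat.sqrt s + 3 ≤ S.cfg.qOf x s := by omega
  calc s ≤ Nat.sqrt s * (Nat.sqrt s + 3) := by nlinarith
    _ ≤ Nat.sqrt s * S.cfg.qOf x s := Nat.mul_le_mul_left _ this

/-- **`m ≤ (⌊√s⌋ + ℓ + 1) q`**, hence `m / q ≤ ⌊√s⌋ + ℓ + 1`. [cite: Hirahara2018, Cor. 4.12 (proof)] -/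
theorem mOf_le_mul : S.cfg.mOf x s ≤ (Nat.sqrt s + S.cfg.ellOf x + 1) * S.cfg.qOf x s := by
  have h1 := S.le_sqrt_mul_qOf x s
  have hq := (S.qOf_spec x s).1
  rw [NqOf_eq] at hq
  rw [mOf_eq]
  nlinarith

/-- `m / q ≤ √s + ℓ + 1` (Cor. 4.12's parameter choice). [cite: Hirahara2018, Cor. 4.12 (proof)] -/
theorem mOf_div_le : S.cfg.mOf x s / S.cfg.qOf x s ≤ Nat.sqrt s + S.cfg.ellOf x + 1 :=
  Nat.div_le_of_le_mul (by rw [mul_comm]; exact S.mOf_le_mul x s)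

/-- **`m ≤ q²`** (so that the design of lines has `m` blocks: `q² ≥ q N_q ≥ 2ℓq + 4⌊√s⌋² + R`). [cite: NisanWigderson1994, Lemma 2.5] -/
theorem mOf_le_sq : S.cfg.mOf x s ≤ S.cfg.qOf x s * S.cfg.qOf x s := by
  have hq := (S.qOf_spec x s).1
  have hq1 : 1 ≤ S.cfg.qOf x s := (S.qOf_spec x s).2.1.one_lt.le
  rw [NqOf_eq] at hq
  have hs := Nat.lt_succ_sqrt s
  rw [mOf_eq]
  -- `s ≤ 2⌊√s⌋ q`, `ℓ q ≤ ℓ q`, `R ≤ q`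
  have h1 : s ≤ 2 * Nat.sqrt s * S.cfg.qOf x s := by nlinarith [S.le_sqrt_mul_qOf x s]
  nlinarith

/-- `2 ≤ m`, `n₀ ≤ m`, `0 < m`. [folklore] -/
theorem two_le_mOf : 2 ≤ S.cfg.mOf x s := by
  have := S.B_le_ROf x.length; have := S.le_B; rw [mOf_eq]; omega
/-- The threshold `n₀` of Lemma 4.17 is below `m`. [folklore] -/
theorem n₀_le_mOf : S.n₀ ≤ S.cfg.mOf x s := by
  have := S.B_le_ROf x.length; have := S.le_B; rw [mOf_eq]; omega

end Params

/-! ### Domination: every parameter is below `(n+2)^D ≤ V < T` -/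

section Domination

/-- The numeral bound `Bₙ = (n+2)^D`. [folklore] -/
def Bn (n : ℕ) : ℕ := (n + 2) ^ S.D

/-- `Nbig(n) = Bn n = (n+2)^D`. [folklore] -/
theorem Nbig_eval (n : ℕ) : S.cfg.Nbig.eval n = S.Bn n := by simp [cfg, Bn]

/-- `V(n, t) = t + Bn n`. [folklore] -/
theorem VOf_eq (n t : ℕ) : S.cfg.VOf n t = t + S.Bn n := by rw [NWPar.Cfg.VOf, Nbig_eval]

/-- Lower bounds on the exponent `D`. [folklore] -/
theorem D_ge : 16 * S.cL + 12 ≤ S.D ∧ 4 * 2 ^ S.eL ≤ S.D ∧ 3 ≤ S.D := by unfold D; omega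

/-- `log₂ (a b) ≤ log₂ a + log₂ b + 1` (twin of `log_mul_le` in `Complexity/MurrayWilliams2018Lemma13.lean`, not imported:
unrelated heavy closure; librarian consolidation candidate). [folklore] -/
theorem log_mul_le (a b : ℕ) : Nat.log 2 (a * b) ≤ Nat.log 2 a + Nat.log 2 b + 1 := by
  rcases Nat.eq_zero_or_pos a with rfl | ha; · simp
  rcases Nat.eq_zero_or_pos b with rfl | hb; · simp
  have h1 := Nat.lt_pow_succ_log_self one_lt_two a
  have h2 := Nat.lt_pow_succ_log_self one_lt_two b
  have h3 : a * b < 2 ^ (Nat.log 2 a + Nat.log 2 b + 2) := by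
    calc a * b < 2 ^ (Nat.log 2 a + 1) * 2 ^ (Nat.log 2 b + 1) := Nat.mul_lt_mul'' h1 h2
      _ = 2 ^ (Nat.log 2 a + Nat.log 2 b + 2) := by rw [← pow_add]; ring_nf
  have := Nat.log_lt_of_lt_pow (Nat.mul_ne_zero ha.ne' hb.ne') h3
  omega

/-- `log₂ Bₙ ≤ D (log₂ n + 2)` for `n ≥ 2`. [folklore] -/
theorem log_Bn_le {n : ℕ} (hn : 2 ≤ n) : Nat.log 2 (S.Bn n) ≤ S.D * (Nat.log 2 n + 2) := by
  have h1 := log_pow_succ_le (k := n + 2) (a := S.D) (by omega) (by have := S.D_ge; omega)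
  have h2 := log_add_two_le hn
  rw [Bn]
  calc Nat.log 2 ((n + 2) ^ S.D) ≤ S.D * (Nat.log 2 (n + 2) + 1) := by omega
    _ ≤ S.D * (Nat.log 2 n + 2) := Nat.mul_le_mul_left _ (by omega)

variable {x : List Bool} {s : ℕ}

/-- The working hypotheses on an instance in the main regime: `n ≥ A + B + cP + 4`, `s < n + cP`. [folklore] -/
structure Main (S : Setup) (x : List Bool) (s : ℕ) : Prop where
  hn : S.A + S.B + S.cP + 4 ≤ x.length
  hs : s < x.length + S.cP

/-- In the main regime `|x| ≥ 2`. [folklore] -/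
theorem Main.two_le (h : S.Main x s) : 2 ≤ x.length := by have := h.hn; omega

/-- `R ≤ (n+2)²`. [folklore] -/
theorem ROf_le_sq (h : S.Main x s) : S.cfg.ROf x.length ≤ (x.length + 2) ^ 2 := by
  have hL : Nat.log 2 x.length ≤ x.length := (Nat.log_lt_self 2 (by have := h.hn; omega)).le
  have hn := h.hn
  rw [ROf_eq]
  calc S.A * (Nat.log 2 x.length + 1) + S.B ≤ S.A * (x.length + 1) + S.B * 1 := by nlinarith
    _ ≤ (S.A + S.B) * (x.length + 2) := by nlinarith
    _ ≤ (x.length + 2) * (x.length + 2) := Nat.mul_le_mul_right _ (by omega)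
    _ = (x.length + 2) ^ 2 := (sq _).symm

/-- `s ≤ (n+2)²`. [folklore] -/
theorem s_le_sq (h : S.Main x s) : s ≤ (x.length + 2) ^ 2 := by
  have := h.hs; have := h.hn; nlinarith

/-- **`q ≤ (n+2)^{8cL+6}`.** [folklore] -/
theorem qOf_le (h : S.Main x s) : S.cfg.qOf x s ≤ (x.length + 2) ^ (8 * S.cL + 6) := by
  have h2 := h.two_le
  have hq := (S.qOf_spec x s).2.2
  have hℓ : S.cfg.ellOf x ≤ (x.length + 2) ^ (8 * S.cL) := (Nat.lt_two_pow_self).le.trans (S.two_pow_ellOf_le x h2)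
  have hsq : Nat.sqrt s ≤ (x.length + 2) ^ 2 := (Nat.sqrt_le_self s).trans (S.s_le_sq h)
  have hR := S.ROf_le_sq h
  have hp1 : 1 ≤ (x.length + 2) ^ (8 * S.cL) := Nat.one_le_pow _ _ (by omega)
  have hp2 : (x.length + 2) ^ 2 ≤ (x.length + 2) ^ (8 * S.cL + 2) := Nat.pow_le_pow_right (by omega) (by omega)
  have hp3 : (x.length + 2) ^ (8 * S.cL) ≤ (x.length + 2) ^ (8 * S.cL + 2) := Nat.pow_le_pow_right (by omega) (by omega)
  have h16 : 12 ≤ (x.length + 2) ^ 4 := by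
    calc (12 : ℕ) ≤ 2 ^ 4 := by norm_num
      _ ≤ (x.length + 2) ^ 4 := Nat.pow_le_pow_left (by omega) 4
  rw [NqOf_eq] at hq
  calc S.cfg.qOf x s ≤ 2 * (2 * S.cfg.ellOf x + 2 * Nat.sqrt s + S.cfg.ROf x.length) + 2 := hq
    _ ≤ 12 * (x.length + 2) ^ (8 * S.cL + 2) := by omega
    _ ≤ (x.length + 2) ^ 4 * (x.length + 2) ^ (8 * S.cL + 2) := Nat.mul_le_mul_right _ h16
    _ = (x.length + 2) ^ (8 * S.cL + 6) := by rw [← pow_add]; ring_nf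

/-- **`m ≤ Bₙ`.** [folklore] -/
theorem mOf_le_Bn (h : S.Main x s) : S.cfg.mOf x s ≤ S.Bn x.length := by
  have hq := S.qOf_le h
  have hD := S.D_ge
  calc S.cfg.mOf x s ≤ S.cfg.qOf x s * S.cfg.qOf x s := S.mOf_le_sq x s
    _ ≤ (x.length + 2) ^ (8 * S.cL + 6) * (x.length + 2) ^ (8 * S.cL + 6) := Nat.mul_le_mul hq hq
    _ = (x.length + 2) ^ (16 * S.cL + 12) := by rw [← pow_add]; ring_nf
    _ ≤ S.Bn x.length := Nat.pow_le_pow_right (by omega) hD.1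

/-- `q ≤ Bn |x|` in the main regime. [folklore] -/
theorem qOf_le_Bn (h : S.Main x s) : S.cfg.qOf x s ≤ S.Bn x.length :=
  (S.qOf_le h).trans (Nat.pow_le_pow_right (by omega) (by have := S.D_ge; omega))

/-- `2^ℓ ≤ Bn |x|` in the main regime. [folklore] -/
theorem two_pow_ellOf_le_Bn (h : S.Main x s) : 2 ^ S.cfg.ellOf x ≤ S.Bn x.length :=
  (S.two_pow_ellOf_le x h.two_le).trans (Nat.pow_le_pow_right (by omega) (by have := S.D_ge; omega))

/-- `ℓ ≤ Bn |x|` in the main regime. [folklore] -/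
theorem ellOf_le_Bn (h : S.Main x s) : S.cfg.ellOf x ≤ S.Bn x.length := (Nat.lt_two_pow_self).le.trans (S.two_pow_ellOf_le_Bn h)

/-- `e(n) ≤ Bn n`. [folklore] -/
theorem eOf_le_Bn (n : ℕ) : S.cfg.eOf n ≤ S.Bn n := by
  rw [eOf_eq]; exact Nat.pow_le_pow_right (by omega) S.D_ge.2.2

/-- `n ≤ Bn n`. [folklore] -/
theorem self_le_Bn (n : ℕ) : n ≤ S.Bn n := (Nat.le_add_right n 2).trans (Nat.le_self_pow (by have := S.D_ge; omega) _)

/-- `s ≤ Bn |x|` in the main regime. [folklore] -/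
theorem s_le_Bn (h : S.Main x s) : s ≤ S.Bn x.length :=
  (S.s_le_sq h).trans (Nat.pow_le_pow_right (by omega) (by have := S.D_ge; omega))

/-- **`pL(n + e) ≤ Bₙ`** (the list index is a small numeral). [folklore] -/
theorem pL_le_Bn (n : ℕ) : S.pL.eval (n + S.cfg.eOf n) ≤ S.Bn n := by
  rw [eOf_eq]
  have h1 : n + (n + 2) ^ 3 + 2 ≤ (n + 2) ^ 4 := by
    have h : n + 2 ≤ (n + 2) ^ 3 := Nat.le_self_pow (by norm_num) _
    calc n + (n + 2) ^ 3 + 2 = (n + 2) + (n + 2) ^ 3 := by ring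
      _ ≤ (n + 2) ^ 3 + (n + 2) ^ 3 := Nat.add_le_add_right h _
      _ = 2 * (n + 2) ^ 3 := by ring
      _ ≤ (n + 2) * (n + 2) ^ 3 := Nat.mul_le_mul_right _ (by omega)
      _ = (n + 2) ^ 4 := by ring
  calc S.pL.eval (n + (n + 2) ^ 3) ≤ (n + (n + 2) ^ 3 + 2) ^ (2 ^ S.eL) := by have := S.heL (n + (n + 2) ^ 3); omega
    _ ≤ ((n + 2) ^ 4) ^ (2 ^ S.eL) := Nat.pow_le_pow_left h1 _
    _ = (n + 2) ^ (4 * 2 ^ S.eL) := by rw [← pow_mul]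
    _ ≤ S.Bn n := Nat.pow_le_pow_right (by omega) S.D_ge.2.1

/-- `Bₙ ≤ V < T`. [folklore] -/
theorem Bn_lt_TOf (n t : ℕ) : S.Bn n < S.cfg.TOf n t := by
  have := S.cfg.VOf_lt_TOf n t; rw [VOf_eq] at this; omega

/-- The ruler budget `T(n, t)` exceeds `t`. [folklore] -/
theorem t_lt_TOf (n t : ℕ) : t < S.cfg.TOf n t := by
  have := S.cfg.VOf_lt_TOf n t; rw [VOf_eq] at this; omega

/-- **`J ≤ log₂ n + D + 3`** in the main regime with `t < 2ⁿ` (the doubly logarithmic price of the budget).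
[cite: Hirahara2018, Lemma 4.19, Thm. 4.21 (proof: "`O(log log t₁) = O(log n)`" unless `t₁ ≥ 2ⁿ`)] -/
theorem JOf_le {n t : ℕ} (hn : 2 ≤ n) (ht : t < 2 ^ n) : S.cfg.JOf n t ≤ Nat.log 2 n + S.D + 3 := by
  have hLn : Nat.log 2 n ≤ n := (Nat.log_lt_self 2 (by omega)).le
  have hVeq : S.cfg.VOf n t = t + S.Bn n := S.VOf_eq n t
  have hBn1 : 1 ≤ S.Bn n := Nat.one_le_pow _ _ (by omega)
  have hlogBn := S.log_Bn_le hn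
  have hBn : S.Bn n < 2 ^ (S.D * (Nat.log 2 n + 2) + 1) :=
    (Nat.lt_pow_succ_log_self one_lt_two _).trans_le (Nat.pow_le_pow_right (by norm_num) (by omega))
  have hVlt : S.cfg.VOf n t < 2 ^ (n + S.D * (Nat.log 2 n + 2) + 1) := by
    rw [hVeq]
    calc t + S.Bn n < 2 ^ n + 2 ^ (S.D * (Nat.log 2 n + 2) + 1) := Nat.add_lt_add ht hBn
      _ ≤ 2 ^ (n + S.D * (Nat.log 2 n + 2)) + 2 ^ (n + S.D * (Nat.log 2 n + 2)) :=
          Nat.add_le_add (Nat.pow_le_pow_right (by norm_num) (by omega)) (Nat.pow_le_pow_right (by norm_num) (by omega))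
      _ = 2 ^ (n + S.D * (Nat.log 2 n + 2) + 1) := by rw [pow_succ]; ring
  have hV0 : S.cfg.VOf n t ≠ 0 := by rw [hVeq]; omega
  have hlogV : Nat.log 2 (S.cfg.VOf n t) < n + S.D * (Nat.log 2 n + 2) + 1 := Nat.log_lt_of_lt_pow hV0 hVlt
  have hL1 : (encodeNat (S.cfg.VOf n t)).length ≤ (S.D + 1) * (n + 2) := by
    have h1 := TM2Pass.length_encodeNat_le (S.cfg.VOf n t)
    have h4 : S.D * (Nat.log 2 n + 2) ≤ S.D * (n + 2) := Nat.mul_le_mul_left _ (by omega)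
    nlinarith
  rw [NWPar.Cfg.JOf]
  have h5 := TM2Pass.length_encodeNat_le (encodeNat (S.cfg.VOf n t)).length
  have h6 : Nat.log 2 (encodeNat (S.cfg.VOf n t)).length ≤ Nat.log 2 ((S.D + 1) * (n + 2)) := Nat.log_mono_right hL1
  have h7 := log_mul_le (S.D + 1) (n + 2)
  have h8 : Nat.log 2 (S.D + 1) ≤ S.D := Nat.lt_succ_iff.1 (Nat.log_lt_self 2 (by omega))
  have h9 := log_add_two_le hn
  calc (encodeNat (encodeNat (S.cfg.VOf n t)).length).length ≤ Nat.log 2 (encodeNat (S.cfg.VOf n t)).length + 1 := h5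
    _ ≤ Nat.log 2 ((S.D + 1) * (n + 2)) + 1 := Nat.add_le_add_right h6 _
    _ ≤ Nat.log 2 (S.D + 1) + Nat.log 2 (n + 2) + 2 := by omega
    _ ≤ S.D + (Nat.log 2 n + 1) + 2 := by omega
    _ = Nat.log 2 n + S.D + 3 := by ring

end Domination

/-! ### The yes side: NW outputs of a compressible `x` avoid the random strings (Lemma 4.10) -/

section Yes

variable {x : List Bool} {s : ℕ}

/-- `2^{|expPad 1 (1^J)|} = T`. [folklore] -/
theorem two_pow_length_expPad (n t : ℕ) : 2 ^ (expPad 1 (ones (S.cfg.JOf n t))).length = S.cfg.TOf n t := by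
  rw [length_expPad_one, NWPar.Cfg.TOf, List.length_replicate]

/-- The output on seed `z` is the generic NW output on `enc(1ᵉ, x)`. [folklore] -/
theorem yOf_eq (z : List Bool) : NWSamp.yOf S.cfg x s z =
    NWStr.nwOut (S.cfg.qOf x s) (S.enc (boolPair (ones (S.cfg.eOf x.length)) x)) (LineDesign.lineDesign (S.cfg.qOf x s) (S.cfg.ellOf x) (S.cfg.mOf x s)) z := rfl

/-- **The payload of the yes-program is short**: `|payload| + 2J + cY + 2 ≤ m` for `|d₀| ≤ s`, `|z| = d`.
[cite: Hirahara2018, Thm. 4.11 (proof: "`K_{t₁}(NW(z)) ≤ K_t(x) + d + O(log) < r(m)`")] -/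
theorem payloadY_short (h : S.Main x s) {t : ℕ} (ht : t < 2 ^ x.length) {d₀ z : List Bool} (hd : d₀.length ≤ s) (hz : z.length = S.cfg.dOf x s) :
    (NWOut.payloadY (S.cfg.eOf x.length) (S.cfg.ellOf x) (S.cfg.qOf x s) (S.cfg.mOf x s) d₀ z).length + 2 * S.cfg.JOf x.length t + S.cY + 2 ≤
      S.cfg.mOf x s := by
  have h2 := h.two_le
  have hpl := NWOut.length_payloadY_le (z := z) (S.eOf_le_Bn x.length) (S.ellOf_le_Bn h) (S.qOf_le_Bn h) (S.mOf_le_Bn h) (hd.trans (S.s_le_Bn h))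
  have hlog := S.log_Bn_le h2
  have hJ := S.JOf_le h2 ht
  have hm : s + z.length + (S.A * (Nat.log 2 x.length + 1) + S.B) = S.cfg.mOf x s := by rw [mOf_eq, ROf_eq, hz, dOf_eq]
  have e1 : S.D * (Nat.log 2 x.length + 2) = S.D * Nat.log 2 x.length + 2 * S.D := by ring
  have e2 : S.A * (Nat.log 2 x.length + 1) = 54 * (S.D * Nat.log 2 x.length) + 54 * S.D + 46 * Nat.log 2 x.length + 46 := by
    rw [show S.A = 54 * S.D + 46 from rfl]; ring
  have hB : S.B = S.cY + 54 * S.D + 48 + S.n₀ := rfl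
  omega

/-- **The payload is below `PY(n) = (n+2)^{D+1}`** (so the budget of Lemma 4.10 is below `t₁`). [folklore] -/
theorem payloadY_le_PY (h : S.Main x s) {d₀ z : List Bool} (hd : d₀.length ≤ s) (hz : z.length = S.cfg.dOf x s) :
    (NWOut.payloadY (S.cfg.eOf x.length) (S.cfg.ellOf x) (S.cfg.qOf x s) (S.cfg.mOf x s) d₀ z).length ≤ S.cfg.PY.eval x.length := by
  have h2 := h.two_le
  have hn := h.hn
  have hpl := NWOut.length_payloadY_le (z := z) (S.eOf_le_Bn x.length) (S.ellOf_le_Bn h) (S.qOf_le_Bn h) (S.mOf_le_Bn h) (hd.trans (S.s_le_Bn h))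
  have hlog := S.log_Bn_le h2
  have hL : Nat.log 2 x.length ≤ x.length := (Nat.log_lt_self 2 (by omega)).le
  have hsB := S.s_le_sq h
  have hdm : z.length ≤ S.Bn x.length := by rw [hz, dOf_eq]; have := S.mOf_le_Bn h; rw [mOf_eq] at this; omega
  have hA : S.A = 54 * S.D + 46 := rfl
  have hsq : (x.length + 2) ^ 2 ≤ S.Bn x.length := Nat.pow_le_pow_right (by omega) (by have := S.D_ge; omega)
  have hPY : S.cfg.PY.eval x.length = (x.length + 2) ^ (S.D + 1) := by simp [cfg]
  rw [hPY, pow_succ]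
  have hlin : 18 * (S.D * (Nat.log 2 x.length + 2) + 1) + 18 ≤ (x.length + 2) ^ 2 := by
    calc 18 * (S.D * (Nat.log 2 x.length + 2) + 1) + 18 ≤ (18 * S.D + 36) * (x.length + 2) := by nlinarith
      _ ≤ (x.length + 2) * (x.length + 2) := Nat.mul_le_mul_right _ (by omega)
      _ = (x.length + 2) ^ 2 := (sq _).symm
  have h3 : 3 ≤ x.length + 2 := by omega
  calc _ ≤ d₀.length + z.length + 18 * (Nat.log 2 (S.Bn x.length) + 1) + 18 := hpl
    _ ≤ (x.length + 2) ^ 2 + S.Bn x.length + (x.length + 2) ^ 2 := by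
        have : 18 * (Nat.log 2 (S.Bn x.length) + 1) + 18 ≤ 18 * (S.D * (Nat.log 2 x.length + 2) + 1) + 18 := by omega
        omega
    _ ≤ S.Bn x.length * 3 := by rw [Bn] at *; omega
    _ ≤ S.Bn x.length * (x.length + 2) := Nat.mul_le_mul_left _ h3
    _ = (x.length + 2) ^ S.D * (x.length + 2) := by rw [Bn]

/-- **Yes side** (Lemma 4.10 + Lemma 4.17): in the main regime with `t < 2ⁿ`, if `K^t(x) ≤ s` then for every seed
`z ∈ {0,1}^d` the output `NW^{Enc(x)}(z)` lies OUTSIDE the slice `T_{t₁}` of the dense set of `(m−1)`-random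
strings. [cite: Hirahara2018, Thm. 4.11 (proof)] [cite: Hirahara2018, Lemma 4.10] -/
theorem yes_avoid (h : S.Main x s) {t : ℕ} (ht : t < 2 ^ x.length) (hK : S.U.ktAt t x ≤ s) (z : List Bool)
    (hz : z.length = S.cfg.dOf x s) :
    boolPair (NWSamp.yOf S.cfg x s z) (ones (S.cfg.t1Of x.length t)) ∉ S.TL := by
  obtain ⟨d₀, hrun, hlt⟩ := S.U.exists_run_eq_of_ktAt_lt (m := ((s + 1 : ℕ) : ℕ∞)) (lt_of_le_of_lt hK (by exact_mod_cast Nat.lt_succ_self s))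
  have hd : d₀.length ≤ s := Nat.lt_succ_iff.1 (Nat.cast_lt.1 hlt)
  have hT : S.cfg.TOf x.length t = NWOut.rulerLen (ones (S.cfg.JOf x.length t)) := S.cfg.TOf_eq_rulerLen x.length t
  have hBT := S.Bn_lt_TOf x.length t
  -- Lemma 4.10
  have hY := S.hY (ones (S.cfg.JOf x.length t)) d₀ x z (S.cfg.eOf x.length) (S.cfg.ellOf x) (S.cfg.qOf x s) (S.cfg.mOf x s) t hrun
    (by rw [← hT]; exact (S.t_lt_TOf x.length t).le) (by rw [← hT]; exact (S.eOf_le_Bn x.length).trans hBT.le)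
    (by rw [← hT]; exact (S.ellOf_le_Bn h).trans hBT.le) (by rw [← hT]; exact (S.qOf_le_Bn h).trans hBT.le)
    (by rw [← hT]; exact (S.mOf_le_Bn h).trans hBT.le) (by rw [← hT]; exact (hd.trans (S.s_le_Bn h)).trans hBT.le)
  rw [two_pow_length_expPad, List.length_replicate, ← yOf_eq] at hY
  -- the budget is below `t₁`, the bound below `m − 1`
  have hbudget : S.qY.eval (S.cfg.TOf x.length t + (NWOut.payloadY (S.cfg.eOf x.length) (S.cfg.ellOf x) (S.cfg.qOf x s) (S.cfg.mOf x s) d₀ z).length) ≤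
      S.cfg.t1Of x.length t := by
    rw [NWPar.Cfg.t1Of]
    exact TM2Iter.eval_mono _ (Nat.add_le_add_left (S.payloadY_le_PY h hd hz) _)
  have hshort := S.payloadY_short h ht hd hz
  have hle : (NWOut.payloadY (S.cfg.eOf x.length) (S.cfg.ellOf x) (S.cfg.qOf x s) (S.cfg.mOf x s) d₀ z).length +
      2 * S.cfg.JOf x.length t + S.cY ≤ S.cfg.mOf x s - 2 := by omega
  have hKy : S.U.ktAt (S.cfg.t1Of x.length t) (NWSamp.yOf S.cfg x s z) ≤ (S.cfg.mOf x s - 2 : ℕ) :=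
    (S.U.ktAt_anti hbudget _).trans (hY.trans (by exact_mod_cast hle))
  -- Lemma 4.17: members of the slice are `(m-1)`-random
  intro hmem
  have hm := S.two_le_mOf x s
  have hlen : (NWSamp.yOf S.cfg x s z).length = S.cfg.mOf x s := by
    rw [NWSamp.yOf, NWStr.length_nwOut, LineDesign.length_lineDesign]
  have hrand := (S.hT (S.cfg.mOf x s) (S.n₀_le_mOf x s) (S.cfg.t1Of x.length t)).1
    ⟨hlen, by rw [paramEnc, Complexity.unaryEncodeNat_eq_replicate]; exact hmem⟩
  rw [UniversalMachine.mem_randomStrings_iff, hlen] at hrand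
  have := hrand.trans hKy
  norm_cast at this
  omega

end Yes

end Setup

/-! ### The data of the no side: the constants of the reconstruction for the configuration -/

/-- The data of the proof together with the constants of Lemma 4.6/4.9 (`NWRec.exists_ktAt_le`) for the
configuration `S.cfg`. [cite: Hirahara2018, Thm. 4.21 (proof)] -/
structure Setup₂ extends Setup where
  /-- The constants of the reconstruction program. -/
  cN : ℕ
  qN : Polynomial ℕ
  hN : ∀ (u f z w x : List Bool) (n e ℓ q m i idx : ℕ),
    0 < q → 2 ^ ℓ ≤ NWOut.rulerLen u → i < m → z.length = ℓ * q →
    n ≤ NWOut.rulerLen u → e ≤ NWOut.rulerLen u → ℓ ≤ NWOut.rulerLen u → q ≤ NWOut.rulerLen u → i ≤ NWOut.rulerLen u →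
    idx ≤ NWOut.rulerLen u →
    nthF idx (toSetup.dec (boolPair (ones e) (boolPair (ones n)
      (NWStr.predTable (NWRec.sliceCompl toSetup.TL (toSetup.cfg.qY.eval (NWOut.rulerLen u + toSetup.cfg.PY.eval n))) ℓ q f
        (LineDesign.lineDesign q ℓ m) i z w)))) = x →
    toSetup.U.ktAt (qN.eval (2 ^ (expPad 1 u).length + (NWRec.payloadN n e ℓ q i idx (NWStr.tables q f (LineDesign.lineDesign q ℓ m) i z ++ w.drop i)).length)) x ≤
      (NWRec.payloadN n e ℓ q i idx (NWStr.tables q f (LineDesign.lineDesign q ℓ m) i z ++ w.drop i)).length + 2 * u.length + cN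

namespace Setup₂

open Setup

variable (S : Setup₂)

/-- `λ = 4 cL` (`ℓ ≤ λ (log₂ n + 2)`). [folklore] -/
def lam : ℕ := 4 * S.cL
/-- The quadratic constant of the no-side overhead. [folklore] -/
def K₂ : ℕ := 5 * S.lam ^ 2 + 2 * S.lam * (S.A + S.B) + 3 * S.lam + (S.A + S.B) + 22 * S.D + 2
/-- The constant term of the no-side overhead. [folklore] -/
def K₃ : ℕ := 2 * S.D + 72 + S.cN
/-- The linear constant of `m ≤ K'(n+2)²` (for `6m ≤ e`). [folklore] -/
def K' : ℕ := 4 * S.cL * (2 * (8 * S.cL + S.A + S.B + 2 * S.cP + 2) + 2) + S.A + S.B + S.cP + 1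
/-- **The threshold** `N₀`. [folklore] -/
def N0 : ℕ := 6 * S.K' + S.A + S.B + S.cP + 4
/-- **The constant of `σ`.** [cite: Hirahara2018, Cor. 4.12 ("`K_t(x) + O((log n)√K_t(x) + (log n)²)`")] -/
def cσ : ℕ := 4 * S.K₂ + 10 * S.lam + S.K₃ + S.N0 + S.cP
/-- **`σ(n, s) = s + cσ · (log₂ n · ⌊√s⌋ + (log₂ n)² + 1)`.** [cite: Hirahara2018, Cor. 4.23] -/
def σ (n s : ℕ) : ℕ := s + S.cσ * (Nat.log 2 n * Nat.sqrt s + Nat.log 2 n ^ 2 + 1)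
/-- The polynomial bound of the no-side budget. [folklore] -/
def Rτ : Polynomial ℕ :=
  8 * (2 * (X + (X + 2) ^ S.D) + 2) ^ 2 * (4 * (X + (X + 2) ^ S.D) + 6) + 3 * ((X + 2) ^ S.D) ^ 2
/-- **`τ(n, t) = pτ(n + t)`**, `pτ = X + pP + qN ∘ Rτ`. [cite: Hirahara2018, Cor. 4.23 ("some polynomial `τ`")] -/
def pτ : Polynomial ℕ := X + S.pP + S.qN.comp S.Rτ
/-- `τ`. [cite: Hirahara2018, Cor. 4.23] -/
def τ (n t : ℕ) : ℕ := S.pτ.eval (n + t)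

/-- `τ(n, t)` dominates `t`, the printing budget `pP(n)` and the reconstruction budget `qN(Rτ(n+t))`. [folklore] -/
theorem le_τ (n t : ℕ) : t ≤ S.τ n t ∧ S.pP.eval n ≤ S.τ n t ∧ S.qN.eval (S.Rτ.eval (n + t)) ≤ S.τ n t := by
  simp only [τ, pτ, eval_add, eval_X, eval_comp]
  have := TM2Iter.eval_mono S.pP (Nat.le_add_right n t)
  omega

/-- `s ≤ σ(n, s) ≤ s + cσ·(log n·√s + (log n)² + 1)` (the shape of Cor. 4.23's `σ`). [cite: Hirahara2018, Cor. 4.23] -/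
theorem le_σ (n s : ℕ) : s ≤ S.σ n s ∧ S.σ n s ≤ s + S.cσ * (Nat.log 2 n * Nat.sqrt s + Nat.log 2 n ^ 2 + 1) := ⟨Nat.le_add_right _ _, le_rfl⟩

/-! ### The no side: if the outputs rarely hit the random strings, `x` is compressible (Lemma 4.6/4.9) -/

section No

variable {x : List Bool} {s : ℕ}

/-- **`6m ≤ e`** in the main regime (`m ≤ K'(n+2)²`, `e = (n+2)³`, `n + 2 ≥ 6K'`). [cite: Hirahara2018, Thm. 4.7 (`ε`)] -/
theorem six_mOf_le_eOf (h : S.Main x s) (hn : S.N0 ≤ x.length) : 6 * S.cfg.mOf x s ≤ S.cfg.eOf x.length := by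
  have h2 := h.two_le
  have hℓ := S.ellOf_le x h2
  have hq := (S.qOf_spec x s).2.2
  have hL : Nat.log 2 x.length ≤ x.length := (Nat.log_lt_self 2 (by omega)).le
  have hs := h.hs
  have hsq : Nat.sqrt s ≤ x.length + S.cP := (Nat.sqrt_le_self s).trans hs.le
  rw [NqOf_eq, ROf_eq] at hq
  rw [eOf_eq, mOf_eq, ROf_eq]
  have hN0 : S.N0 = 6 * S.K' + S.A + S.B + S.cP + 4 := rfl
  have hK' : S.K' = 4 * S.cL * (2 * (8 * S.cL + S.A + S.B + 2 * S.cP + 2) + 2) + S.A + S.B + S.cP + 1 := rfl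
  -- `ℓ ≤ 4cL(n+2)`, `q ≤ 2K(n+2)+2`
  have hℓn : S.cfg.ellOf x ≤ 4 * S.cL * (x.length + 2) := hℓ.trans (Nat.mul_le_mul_left _ (by omega))
  have hqn : S.cfg.qOf x s ≤ 2 * (8 * S.cL + S.A + S.B + 2 * S.cP + 2) * (x.length + 2) + 2 := by nlinarith
  have hℓq : S.cfg.ellOf x * S.cfg.qOf x s ≤ 4 * S.cL * (2 * (8 * S.cL + S.A + S.B + 2 * S.cP + 2) + 2) * (x.length + 2) ^ 2 := by
    calc S.cfg.ellOf x * S.cfg.qOf x s ≤ (4 * S.cL * (x.length + 2)) * (2 * (8 * S.cL + S.A + S.B + 2 * S.cP + 2) * (x.length + 2) + 2) :=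
          Nat.mul_le_mul hℓn hqn
      _ ≤ (4 * S.cL * (x.length + 2)) * ((2 * (8 * S.cL + S.A + S.B + 2 * S.cP + 2) + 2) * (x.length + 2)) :=
          Nat.mul_le_mul_left _ (by nlinarith)
      _ = _ := by ring
  have hm : s + S.cfg.ellOf x * S.cfg.qOf x s + (S.A * (Nat.log 2 x.length + 1) + S.B) ≤ S.K' * (x.length + 2) ^ 2 := by
    rw [hK']; nlinarith
  calc 6 * (s + S.cfg.ellOf x * S.cfg.qOf x s + (S.A * (Nat.log 2 x.length + 1) + S.B)) ≤ 6 * S.K' * (x.length + 2) ^ 2 := by nlinarith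
    _ ≤ (x.length + 2) * (x.length + 2) ^ 2 := Nat.mul_le_mul_right _ (by omega)
    _ = (x.length + 2) ^ 3 := by ring

/-- The arithmetic of the no-side overhead: with `ℓ ≤ λ(L+2)`, `R ≤ (A+B)(L+2)`, `L ≥ 2`, the description
overhead `5ℓ² + 5ℓ⌊√s⌋ + 2ℓR + 3ℓ + R + 22(D(L+2)+1) + 2L + 2D + 28 + cN` is `≤ cσ' (L⌊√s⌋ + L² + 1)`.
[cite: Hirahara2018, Cor. 4.12 (proof: "`K_t(x) + O(ℓ√K_t(x) + ℓ²)`")] -/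
theorem overhead_arith (ℓ r L R lam AB D cN : ℕ) (hℓ : ℓ ≤ lam * (L + 2)) (hR : R ≤ AB * (L + 2)) (hL : 2 ≤ L) :
    ℓ * (4 * ℓ + 4 * r + 2 * R + 2) + R + (r + ℓ + 1) * ℓ + 22 * (D * (L + 2) + 1) + 22 + 2 * L + 2 * D + 6 + cN ≤
      (4 * (5 * lam ^ 2 + 2 * lam * AB + 3 * lam + AB + 22 * D + 2) + 10 * lam + (2 * D + 72 + cN)) * (L * r + L ^ 2 + 1) := by
  -- step 1: replace `ℓ` by `Λ = lam (L+2)` and `R` by `Rb = AB (L+2)`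
  have h1 : ℓ * (4 * ℓ + 4 * r + 2 * R + 2) + R + (r + ℓ + 1) * ℓ ≤
      5 * (lam * lam * ((L + 2) * (L + 2))) + 5 * (lam * ((L + 2) * r)) + 2 * (lam * AB * ((L + 2) * (L + 2))) + 3 * (lam * (L + 2)) + AB * (L + 2) := by
    have a1 : ℓ * ℓ ≤ (lam * (L + 2)) * (lam * (L + 2)) := Nat.mul_le_mul hℓ hℓ
    have a2 : ℓ * r ≤ (lam * (L + 2)) * r := Nat.mul_le_mul_right _ hℓ
    have a3 : ℓ * R ≤ (lam * (L + 2)) * (AB * (L + 2)) := Nat.mul_le_mul hℓ hR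
    have e1 : ℓ * (4 * ℓ + 4 * r + 2 * R + 2) + R + (r + ℓ + 1) * ℓ = 5 * (ℓ * ℓ) + 5 * (ℓ * r) + 2 * (ℓ * R) + 3 * ℓ + R := by ring
    have e2 : (lam * (L + 2)) * (lam * (L + 2)) = lam * lam * ((L + 2) * (L + 2)) := by ring
    have e3 : (lam * (L + 2)) * r = lam * ((L + 2) * r) := by ring
    have e4 : (lam * (L + 2)) * (AB * (L + 2)) = lam * AB * ((L + 2) * (L + 2)) := by ring
    rw [e2] at a1; rw [e3] at a2; rw [e4] at a3
    rw [e1]; omega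
  -- step 2: `(L+2)² ≤ 4L²`, `(L+2) r ≤ 2 L r`, `L+2 ≤ 4 L²`
  set P := L * L with hP
  set Q := L * r with hQ
  have b1 : (L + 2) * (L + 2) ≤ 4 * P := by rw [hP]; nlinarith
  have b2 : (L + 2) * r ≤ 2 * Q := by rw [hQ]; nlinarith
  have b3 : L + 2 ≤ 4 * P := by rw [hP]; nlinarith
  have c1 : lam * lam * ((L + 2) * (L + 2)) ≤ 4 * (lam * lam * P) := by
    have := Nat.mul_le_mul_left (lam * lam) b1; rwa [show lam * lam * (4 * P) = 4 * (lam * lam * P) by ring] at this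
  have c2 : lam * ((L + 2) * r) ≤ 2 * (lam * Q) := by
    have := Nat.mul_le_mul_left lam b2; rwa [show lam * (2 * Q) = 2 * (lam * Q) by ring] at this
  have c3 : lam * AB * ((L + 2) * (L + 2)) ≤ 4 * (lam * AB * P) := by
    have := Nat.mul_le_mul_left (lam * AB) b1; rwa [show lam * AB * (4 * P) = 4 * (lam * AB * P) by ring] at this
  have c4 : lam * (L + 2) ≤ 4 * (lam * P) := by
    have := Nat.mul_le_mul_left lam b3; rwa [show lam * (4 * P) = 4 * (lam * P) by ring] at this
  have c5 : AB * (L + 2) ≤ 4 * (AB * P) := by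
    have := Nat.mul_le_mul_left AB b3; rwa [show AB * (4 * P) = 4 * (AB * P) by ring] at this
  have c6 : D * (L + 2) ≤ 4 * (D * P) := by
    have := Nat.mul_le_mul_left D b3; rwa [show D * (4 * P) = 4 * (D * P) by ring] at this
  have c7 : L ≤ 4 * P := by rw [hP]; nlinarith
  -- step 3: the right-hand side dominates term by term
  have hRHS : (4 * (5 * lam ^ 2 + 2 * lam * AB + 3 * lam + AB + 22 * D + 2) + 10 * lam + (2 * D + 72 + cN)) * (Q + L ^ 2 + 1) =
      (20 * (lam * lam * P) + 10 * (lam * Q) + 8 * (lam * AB * P) + 12 * (lam * P) + 4 * (AB * P) + 88 * (D * P) + 8 * P + (2 * D + 72 + cN)) +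
      ((10 * lam + 2 * D + 72 + cN) * P + (20 * lam ^ 2 + 8 * lam * AB + 12 * lam + 4 * AB + 88 * D + 8 + 2 * D + 72 + cN) * Q +
        (20 * lam ^ 2 + 8 * lam * AB + 22 * lam + 4 * AB + 88 * D + 8)) := by
    rw [hP]; ring
  rw [hRHS]
  omega

/-- **The payload of the reconstruction program is short**: `≤ m + (m/q)ℓ + 22(D(log₂ n + 2) + 1) + 22`.
[cite: Hirahara2018, Lemma 4.6 (proof), Lemma 4.9] -/
theorem payloadN_bound (h : S.Main x s) {i idx : ℕ} (hi : i < S.cfg.mOf x s) (hidx : idx ≤ S.pL.eval (x.length + S.cfg.eOf x.length))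
    (f z₀ w₀ : List Bool) (hw₀ : w₀.length = S.cfg.mOf x s) :
    (NWRec.payloadN x.length (S.cfg.eOf x.length) (S.cfg.ellOf x) (S.cfg.qOf x s) i idx
        (NWStr.tables (S.cfg.qOf x s) f (LineDesign.lineDesign (S.cfg.qOf x s) (S.cfg.ellOf x) (S.cfg.mOf x s)) i z₀ ++ w₀.drop i)).length ≤
      S.cfg.mOf x s + S.cfg.mOf x s / S.cfg.qOf x s * S.cfg.ellOf x + 22 * (S.D * (Nat.log 2 x.length + 2) + 1) + 22 := by
  have h2 := h.two_le
  have hq := (S.qOf_spec x s).2.1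
  have hpl := NWRec.length_payloadN_le (raw := NWStr.tables (S.cfg.qOf x s) f (LineDesign.lineDesign (S.cfg.qOf x s) (S.cfg.ellOf x) (S.cfg.mOf x s)) i z₀ ++ w₀.drop i)
    (S.self_le_Bn x.length) (S.eOf_le_Bn x.length) (S.ellOf_le_Bn h) (S.qOf_le_Bn h) (hi.le.trans (S.mOf_le_Bn h)) (hidx.trans (S.pL_le_Bn x.length))
  have htab := LineDesign.length_tables_le hq (S.ellOf_le_qOf x s) (S.mOf_le_sq x s) hi f z₀
  have hdiv : i / S.cfg.qOf x s * S.cfg.ellOf x ≤ S.cfg.mOf x s / S.cfg.qOf x s * S.cfg.ellOf x :=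
    Nat.mul_le_mul_right _ (Nat.div_le_div_right hi.le)
  have hlog := S.log_Bn_le h2
  rw [List.length_append, List.length_drop, hw₀] at hpl
  have hlog' : 22 * (Nat.log 2 (S.Bn x.length) + 1) ≤ 22 * (S.D * (Nat.log 2 x.length + 2) + 1) := by omega
  omega

/-- `22(D(L+2)+1) + 22 ≤ (n+2)²` in the main regime. [folklore] -/
theorem logTerm_le_sq (h : S.Main x s) : 22 * (S.D * (Nat.log 2 x.length + 2) + 1) + 22 ≤ (x.length + 2) ^ 2 := by
  have hn := h.hn
  have hA : S.A = 54 * S.D + 46 := rfl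
  have hL : Nat.log 2 x.length ≤ x.length := (Nat.log_lt_self 2 (by omega)).le
  calc 22 * (S.D * (Nat.log 2 x.length + 2) + 1) + 22 ≤ (22 * S.D + 44) * (x.length + 2) := by nlinarith
    _ ≤ (x.length + 2) * (x.length + 2) := Nat.mul_le_mul_right _ (by omega)
    _ = (x.length + 2) ^ 2 := (sq _).symm

/-- **The budget of the reconstruction program is below `τ(n, t)`.** [cite: Hirahara2018, Thm. 4.21 (proof: "`t₄ ≤ τ(|x|, t)` for some polynomial `τ`")] -/
theorem budget_le (h : S.Main x s) (t : ℕ) {P : ℕ} (hP : P ≤ S.cfg.mOf x s + S.cfg.mOf x s / S.cfg.qOf x s * S.cfg.ellOf x + 22 * (S.D * (Nat.log 2 x.length + 2) + 1) + 22) :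
    S.qN.eval (S.cfg.TOf x.length t + P) ≤ S.τ x.length t := by
  refine le_trans (TM2Iter.eval_mono _ ?_) (S.le_τ x.length t).2.2
  have hRτ : S.Rτ.eval (x.length + t) = 8 * (2 * (x.length + t + (x.length + t + 2) ^ S.D) + 2) ^ 2 * (4 * (x.length + t + (x.length + t + 2) ^ S.D) + 6) +
      3 * ((x.length + t + 2) ^ S.D) ^ 2 := by simp [Rτ]
  rw [hRτ]
  -- `T ≤ 8(2V+2)²(4V+6)` with `V ≤ W`
  have hBnmono : S.Bn x.length ≤ (x.length + t + 2) ^ S.D := Nat.pow_le_pow_left (by omega) _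
  have hV : S.cfg.VOf x.length t ≤ x.length + t + (x.length + t + 2) ^ S.D := by rw [S.VOf_eq]; omega
  have hT : S.cfg.TOf x.length t ≤ 8 * (2 * (x.length + t + (x.length + t + 2) ^ S.D) + 2) ^ 2 * (4 * (x.length + t + (x.length + t + 2) ^ S.D) + 6) := by
    refine (S.cfg.TOf_le x.length t).trans ?_
    exact Nat.mul_le_mul (Nat.mul_le_mul_left 8 (Nat.pow_le_pow_left (by omega) 2)) (by omega)
  -- `P ≤ 3 Bₙ²`
  have hB1 : 1 ≤ S.Bn x.length := Nat.one_le_pow _ _ (by omega)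
  have hm := S.mOf_le_Bn h
  have hℓ := S.ellOf_le_Bn h
  have hdivℓ : S.cfg.mOf x s / S.cfg.qOf x s * S.cfg.ellOf x ≤ S.Bn x.length * S.Bn x.length := Nat.mul_le_mul ((Nat.div_le_self _ _).trans hm) hℓ
  have hlt := S.logTerm_le_sq h
  have hsq : (x.length + 2) ^ 2 ≤ S.Bn x.length := Nat.pow_le_pow_right (by omega) (by have := S.D_ge; omega)
  have hPB : P ≤ 3 * ((x.length + t + 2) ^ S.D) ^ 2 := by
    calc P ≤ S.Bn x.length + S.Bn x.length * S.Bn x.length + S.Bn x.length := by omega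
      _ ≤ 3 * (S.Bn x.length * S.Bn x.length) := by nlinarith
      _ ≤ 3 * ((x.length + t + 2) ^ S.D * (x.length + t + 2) ^ S.D) := Nat.mul_le_mul_left 3 (Nat.mul_le_mul hBnmono hBnmono)
      _ = 3 * ((x.length + t + 2) ^ S.D) ^ 2 := by rw [sq]
  omega

/-- From the real agreement bound `(1/2 + 1/(6m)) 2^ℓ ≤ a` and `6m ≤ e` to the integral form of Thm. 4.7:
`(e + 2) 2^ℓ ≤ 2 e a`. [cite: Hirahara2018, Thm. 4.7 (`dist(Enc(x), r) ≤ 1/2 − ε`)] -/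
theorem agree_nat_of_real {m e ℓ a : ℕ} (hm : 0 < m) (hme : 6 * m ≤ e) (h : (1 / 2 + (1 / 6 : ℝ) / m) * 2 ^ ℓ ≤ a) :
    (e + 2) * 2 ^ ℓ ≤ 2 * e * a := by
  have hm' : (0 : ℝ) < m := by exact_mod_cast hm
  have he' : (6 : ℝ) * m ≤ e := by exact_mod_cast hme
  have hepos : (0 : ℝ) < e := by linarith
  have h1 : (1 : ℝ) / e ≤ (1 / 6) / m := by
    rw [div_le_div_iff₀ hepos (by linarith)]; linarith
  have hid : 2 * (e : ℝ) * (1 / 2 + 1 / e) = e + 2 := by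
    rw [mul_add, show 2 * (e : ℝ) * (1 / 2) = e by ring, mul_one_div, mul_div_assoc, div_self hepos.ne', mul_one]
  have h3 : (1 / 2 + 1 / (e : ℝ)) * 2 ^ ℓ ≤ a := le_trans (mul_le_mul_of_nonneg_right (by linarith) (by positivity)) h
  have h2 : ((e : ℝ) + 2) * (2 : ℝ) ^ ℓ ≤ 2 * (e : ℝ) * (a : ℝ) := by
    calc ((e : ℝ) + 2) * 2 ^ ℓ = 2 * e * ((1 / 2 + 1 / e) * 2 ^ ℓ) := by rw [← mul_assoc, hid]
      _ ≤ 2 * e * a := mul_le_mul_of_nonneg_left h3 (by positivity)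
  have h4 : (((e + 2) * 2 ^ ℓ : ℕ) : ℝ) ≤ ((2 * e * a : ℕ) : ℝ) := by push_cast; exact h2
  exact_mod_cast h4

/-- **No side** (Lemma 4.6/4.9 + Lemma 4.17, by contraposition): in the main regime with `t < 2ⁿ`, if
`σ(n, s) < K^{τ(n,t)}(x)` then the NW outputs hit the slice `T_{t₁}` with probability `≥ 1/6` — otherwise the
complement of the slice (of density `≤ 2/3`) would `1/6`-distinguish the generator, and the reconstruction would
print `x` from `σ(n, s)` bits within `τ(n, t)` steps. [cite: Hirahara2018, Thm. 4.11 (proof)] [cite: Hirahara2018, Lemma 4.9] -/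
theorem no_hits (h : S.Main x s) (hn : S.N0 ≤ x.length) {t : ℕ} (ht : t < 2 ^ x.length)
    (hK : (S.σ x.length s : ℕ∞) < S.U.ktAt (S.τ x.length t) x) :
    1 / 6 ≤ uniformProb (S.cfg.dOf x s) {z | boolPair (NWSamp.yOf S.cfg x s z) (ones (S.cfg.t1Of x.length t)) ∈ S.TL} := by
  by_contra hlt
  rw [not_le] at hlt
  have h2 := h.two_le
  have hq := (S.qOf_spec x s).2.1
  have hqpos := hq.pos
  set S' := NWRec.sliceCompl S.TL (S.cfg.t1Of x.length t) with hS'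
  -- density of the slice and the advantage
  have hm0 : 0 < S.cfg.mOf x s := by have := S.two_le_mOf x s; omega
  have hdens : uniformProb (S.cfg.mOf x s) S' ≤ 2 / 3 := by
    have hd := (S.hT (S.cfg.mOf x s) (S.n₀_le_mOf x s) (S.cfg.t1Of x.length t)).2
    rw [IsDense] at hd
    have hset : {y : List Bool | paramEnc (y, S.cfg.t1Of x.length t) ∈ S.TL} = {y | boolPair y (ones (S.cfg.t1Of x.length t)) ∈ S.TL} := by
      ext y; simp [paramEnc, Complexity.unaryEncodeNat_eq_replicate, ones]
    rw [hset] at hd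
    have hc := uniformProb_compl (S.cfg.mOf x s) {y | boolPair y (ones (S.cfg.t1Of x.length t)) ∈ S.TL}
    have : S' = {y | boolPair y (ones (S.cfg.t1Of x.length t)) ∈ S.TL}ᶜ := rfl
    rw [this, hc]; linarith
  have hreal : 5 / 6 < uniformProb (S.cfg.dOf x s) {z | NWSamp.yOf S.cfg x s z ∈ S'} := by
    have hc := uniformProb_compl (S.cfg.dOf x s) {z | boolPair (NWSamp.yOf S.cfg x s z) (ones (S.cfg.t1Of x.length t)) ∈ S.TL}
    have : {z | NWSamp.yOf S.cfg x s z ∈ S'} = {z | boolPair (NWSamp.yOf S.cfg x s z) (ones (S.cfg.t1Of x.length t)) ∈ S.TL}ᶜ := rfl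
    rw [this, hc]; linarith
  have hadv : uniformProb (S.cfg.mOf x s) S' + 1 / 6 ≤ uniformProb (S.cfg.ellOf x * S.cfg.qOf x s)
      {z | NWStr.nwOut (S.cfg.qOf x s) (S.cfg.fOf x) (List.ofFn fun j : Fin (S.cfg.mOf x s) => NWStr.wordList (LineDesign.lineWordT hqpos (S.cfg.ellOf x) j)) z ∈ S'} := by
    rw [← LineDesign.lineDesign_eq_ofFn hqpos, ← dOf_eq]
    change uniformProb (S.cfg.mOf x s) S' + 1 / 6 ≤ uniformProb (S.cfg.dOf x s) {z | NWSamp.yOf S.cfg x s z ∈ S'}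
    linarith
  -- the hybrid argument / Yao's predictor (Lemma 4.6, first part)
  obtain ⟨i, hi, z₀, w₀, hz₀, hw₀, hagree⟩ := NWStr.exists_predTable_agree S' (fun j => LineDesign.lineWordT hqpos (S.cfg.ellOf x) j) (S.cfg.fOf x) hm0 hadv
  rw [← LineDesign.lineDesign_eq_ofFn hqpos] at hagree
  -- list decoding (Thm. 4.7)
  have hrlen : (NWStr.predTable S' (S.cfg.ellOf x) (S.cfg.qOf x s) (S.cfg.fOf x) (LineDesign.lineDesign (S.cfg.qOf x s) (S.cfg.ellOf x) (S.cfg.mOf x s)) i z₀ w₀).length =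
      2 ^ S.ell x.length (S.cfg.eOf x.length) := by rw [NWStr.length_predTable, ellOf_eq]
  have hagreeN : (S.cfg.eOf x.length + 2) * 2 ^ S.ell x.length (S.cfg.eOf x.length) ≤ 2 * S.cfg.eOf x.length *
      NWStr.agreeCount (NWStr.predTable S' (S.cfg.ellOf x) (S.cfg.qOf x s) (S.cfg.fOf x) (LineDesign.lineDesign (S.cfg.qOf x s) (S.cfg.ellOf x) (S.cfg.mOf x s)) i z₀ w₀) (S.cfg.fOf x) := by
    rw [← ellOf_eq]; exact agree_nat_of_real hm0 (S.six_mOf_le_eOf h hn) hagree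
  obtain ⟨idx, hidx, hdecx⟩ := S.hdecode x.length (S.cfg.eOf x.length) x _ rfl (S.one_le_eOf x.length) hrlen hagreeN
  -- the reconstruction program (Lemma 4.6/4.9, `K`-form)
  have hT : S.cfg.TOf x.length t = NWOut.rulerLen (ones (S.cfg.JOf x.length t)) := S.cfg.TOf_eq_rulerLen x.length t
  have hBT := S.Bn_lt_TOf x.length t
  have hdecx' : nthF idx (S.dec (boolPair (ones (S.cfg.eOf x.length)) (boolPair (ones x.length)
      (NWStr.predTable (NWRec.sliceCompl S.TL (S.cfg.qY.eval (NWOut.rulerLen (ones (S.cfg.JOf x.length t)) + S.cfg.PY.eval x.length)))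
        (S.cfg.ellOf x) (S.cfg.qOf x s) (S.cfg.fOf x) (LineDesign.lineDesign (S.cfg.qOf x s) (S.cfg.ellOf x) (S.cfg.mOf x s)) i z₀ w₀)))) = x := by
    rw [← hT]; exact hdecx
  have hKx := S.hN (ones (S.cfg.JOf x.length t)) (S.cfg.fOf x) z₀ w₀ x x.length (S.cfg.eOf x.length) (S.cfg.ellOf x) (S.cfg.qOf x s)
    (S.cfg.mOf x s) i idx hqpos (by rw [← hT]; exact (S.two_pow_ellOf_le_Bn h).trans hBT.le) hi hz₀
    (by rw [← hT]; exact (S.self_le_Bn x.length).trans hBT.le) (by rw [← hT]; exact (S.eOf_le_Bn x.length).trans hBT.le)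
    (by rw [← hT]; exact (S.ellOf_le_Bn h).trans hBT.le) (by rw [← hT]; exact (S.qOf_le_Bn h).trans hBT.le)
    (by rw [← hT]; exact (hi.le.trans (S.mOf_le_Bn h)).trans hBT.le) (by rw [← hT]; exact (hidx.trans (S.pL_le_Bn x.length)).trans hBT.le) hdecx'
  rw [Setup.two_pow_length_expPad, List.length_replicate] at hKx
  -- the payload is short, the budget is small
  have hpay := S.payloadN_bound h hi hidx (S.cfg.fOf x) z₀ w₀ hw₀
  have hbud := S.budget_le h t hpay
  have hJ := S.JOf_le h2 ht
  have hℓ := S.ellOf_le x h2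
  have hdivm := S.mOf_div_le x s
  have hqle := (S.qOf_spec x s).2.2
  have hL2 : 2 ≤ Nat.log 2 x.length := Nat.le_log_of_pow_le one_lt_two (by have := h.hn; omega)
  have hRb : S.cfg.ROf x.length ≤ (S.A + S.B) * (Nat.log 2 x.length + 2) := by
    rw [ROf_eq, Nat.add_mul]
    exact Nat.add_le_add (Nat.mul_le_mul_left _ (Nat.le_succ _)) (Nat.le_mul_of_pos_right _ (by omega))
  have hover := overhead_arith (S.cfg.ellOf x) (Nat.sqrt s) (Nat.log 2 x.length) (S.cfg.ROf x.length) S.lam (S.A + S.B) S.D S.cN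
    (by rw [show S.lam = 4 * S.cL from rfl]; exact hℓ) hRb hL2
  have hσ : S.cfg.mOf x s + S.cfg.mOf x s / S.cfg.qOf x s * S.cfg.ellOf x + 22 * (S.D * (Nat.log 2 x.length + 2) + 1) + 22 +
      2 * S.cfg.JOf x.length t + S.cN ≤ S.σ x.length s := by
    rw [σ, show S.cσ = 4 * S.K₂ + 10 * S.lam + S.K₃ + S.N0 + S.cP from rfl, show S.K₂ = 5 * S.lam ^ 2 + 2 * S.lam * (S.A + S.B) + 3 * S.lam + (S.A + S.B) + 22 * S.D + 2 from rfl,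
      show S.K₃ = 2 * S.D + 72 + S.cN from rfl, mOf_eq]
    rw [NqOf_eq] at hqle
    -- `m/q ≤ ⌊√s⌋ + ℓ + 1`, `q ≤ 4ℓ + 4⌊√s⌋ + 2R + 2`
    have hdq : (s + S.cfg.ellOf x * S.cfg.qOf x s + S.cfg.ROf x.length) / S.cfg.qOf x s * S.cfg.ellOf x ≤ (Nat.sqrt s + S.cfg.ellOf x + 1) * S.cfg.ellOf x := by
      rw [← mOf_eq]; exact Nat.mul_le_mul_right _ hdivm
    have hℓq : S.cfg.ellOf x * S.cfg.qOf x s ≤ S.cfg.ellOf x * (4 * S.cfg.ellOf x + 4 * Nat.sqrt s + 2 * S.cfg.ROf x.length + 2) :=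
      Nat.mul_le_mul_left _ (by omega)
    have hbig : (4 * (5 * S.lam ^ 2 + 2 * S.lam * (S.A + S.B) + 3 * S.lam + (S.A + S.B) + 22 * S.D + 2) + 10 * S.lam + (2 * S.D + 72 + S.cN)) *
        (Nat.log 2 x.length * Nat.sqrt s + Nat.log 2 x.length ^ 2 + 1) ≤
        (4 * (5 * S.lam ^ 2 + 2 * S.lam * (S.A + S.B) + 3 * S.lam + (S.A + S.B) + 22 * S.D + 2) + 10 * S.lam + (2 * S.D + 72 + S.cN) + S.N0 + S.cP) *
        (Nat.log 2 x.length * Nat.sqrt s + Nat.log 2 x.length ^ 2 + 1) := Nat.mul_le_mul_right _ (by omega)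
    omega
  have hfin : S.U.ktAt (S.τ x.length t) x ≤ (S.σ x.length s : ℕ∞) :=
    (S.U.ktAt_anti hbud x).trans (hKx.trans (by exact_mod_cast (by omega)))
  exact absurd hK (not_lt.2 hfin)

end No

/-! ### The guards, the promise problem of the test, and the separating language -/

section Assembly

/-- Strict comparison of unary numerals: `⟨1ᵃ, 1ᵇ⟩ ↦ [a < b]` (`ltFn` on `2ᵃ − 1 < 2ᵇ − 1`). [folklore] -/
def ultF : List Bool → List Bool := ltFn

/-- `ultF ⟨1ᵃ, 1ᵇ⟩ = [a < b]`. [folklore] -/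
theorem ultF_apply (a b : ℕ) : ultF (boolPair (ones a) (ones b)) = [decide (a < b)] := by
  rw [ultF, ltFn_boolPair, Brick.bitsToNat_ones, Brick.bitsToNat_ones]
  congr 1
  rw [decide_eq_decide]
  have h1 := Nat.one_le_two_pow (n := a); have h2 := Nat.one_le_two_pow (n := b)
  rw [tsub_lt_tsub_iff_right h1, Nat.pow_lt_pow_iff_right one_lt_two]

/-- `ultF` outputs one bit. [folklore] -/
theorem oneBit_ultF : OneBit ultF := oneBit_ltFn

/-- **Guard 1** (yes-trivial instances): `n < N₀ ∨ n + cP ≤ s`. [folklore] -/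
def g1F : List Bool → List Bool :=
  orFn (ultF ∘ fanoutFn NWPar.nF fun _ => ones S.N0) (notFn (ultF ∘ fanoutFn NWPar.SS fun w => NWPar.nF w ++ (fun _ => ones S.cP) w))

/-- The first guard on an instance: `|x| < N0 ∨ |x| + cP ≤ s`. [folklore] -/
theorem g1F_inst (x : List Bool) (t s : ℕ) : S.g1F (NWPar.inst x t s) = [decide (x.length < S.N0 ∨ x.length + S.cP ≤ s)] := by
  have ha : (ultF ∘ fanoutFn NWPar.nF fun _ => ones S.N0) (NWPar.inst x t s) = [decide (x.length < S.N0)] := by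
    simp only [Function.comp_apply, fanoutFn_apply, NWPar.nF_inst, ultF_apply]
  have hb : (notFn (ultF ∘ fanoutFn NWPar.SS fun w => NWPar.nF w ++ (fun _ => ones S.cP) w)) (NWPar.inst x t s) = [!decide (s < x.length + S.cP)] := by
    rw [notFn_apply]
    simp only [Function.comp_apply, fanoutFn_apply, NWPar.SS_inst, NWPar.nF_inst]
    rw [show ones x.length ++ ones S.cP = ones (x.length + S.cP) by simp [ones], ultF_apply]
  rw [g1F, orFn_apply ha hb]
  congr 1
  rw [Bool.eq_iff_iff]
  simp only [Bool.or_eq_true, Bool.not_eq_true', decide_eq_true_eq, decide_eq_false_iff_not, not_lt]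

/-- The first guard is in `FP`. [folklore] -/
theorem g1F_mem_FP : S.g1F ∈ FP :=
  orFn_mem_FP (comp_mem_FP ltFn_mem_FP (fanoutFn_mem_FP NWPar.nF_mem_FP (const_mem_FP _)))
    (notFn_mem_FP (comp_mem_FP ltFn_mem_FP (fanoutFn_mem_FP NWPar.SS_mem_FP (append_mem_FP NWPar.nF_mem_FP (const_mem_FP _)))))

/-- **Guard 2** (the exponential regime): `n ≤ log₂ t`, i.e. `2ⁿ ≤ t` for `n ≥ 1`. [cite: Hirahara2018, Thm. 4.21 (proof: "otherwise `t₁ ≥ 2ⁿ`")] -/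
def g2F : List Bool → List Bool := notFn (ultF ∘ fanoutFn (logFn ∘ NWPar.TT) NWPar.nF)

/-- The second guard on an instance: `|x| ≤ log₂ t`. [folklore] -/
theorem g2F_inst (x : List Bool) (t s : ℕ) : g2F (NWPar.inst x t s) = [decide (x.length ≤ Nat.log 2 t)] := by
  rw [g2F, notFn_apply (b := decide (Nat.log 2 t < x.length))]
  · congr 1
    by_cases h : Nat.log 2 t < x.length
    · rw [decide_eq_true h, decide_eq_false (by omega)]; rfl
    · rw [decide_eq_false h, decide_eq_true (by omega)]; rfl
  · simp only [Function.comp_apply, fanoutFn_apply, NWPar.TT_inst, NWPar.nF_inst, logFn, List.length_replicate, ultF_apply]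

/-- The second guard is in `FP`. [folklore] -/
theorem g2F_mem_FP : g2F ∈ FP :=
  notFn_mem_FP (comp_mem_FP ltFn_mem_FP (fanoutFn_mem_FP (comp_mem_FP logFn_mem_FP NWPar.TT_mem_FP) NWPar.nF_mem_FP))

/-- `n ≤ log₂ t ↔ 2ⁿ ≤ t` for `n ≥ 1`. [folklore] -/
theorem le_log_iff {n t : ℕ} (hn : 1 ≤ n) : n ≤ Nat.log 2 t ↔ 2 ^ n ≤ t := by
  rcases Nat.eq_zero_or_pos t with rfl | ht
  · simp; omega
  · exact Nat.le_log_iff_pow_le one_lt_two ht.ne'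

/-- The guard languages. [folklore] -/
def G1 : Language Bool := {w | S.g1F w = [true]}
/-- The language of the second guard (`2^{|x|} ≤ t`, the exhaustive-search regime). [folklore] -/
def G2 : Language Bool := {w | g2F w = [true]}

/-- The first guard language is in `P`. [folklore] -/
theorem G1_mem_P : S.G1 ∈ Classes.P := setOf_apply_eq_apply_mem_P S.g1F_mem_FP (const_mem_FP [true])
/-- The second guard language is in `P`. [folklore] -/
theorem G2_mem_P : G2 ∈ Classes.P := setOf_apply_eq_apply_mem_P g2F_mem_FP (const_mem_FP [true])

/-- Membership of an instance in the first guard language. [folklore] -/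
theorem inst_mem_G1_iff (x : List Bool) (t s : ℕ) : NWPar.inst x t s ∈ S.G1 ↔ x.length < S.N0 ∨ x.length + S.cP ≤ s := by
  change S.g1F (NWPar.inst x t s) = [true] ↔ _; rw [g1F_inst]; simp

/-- Membership of an instance in the second guard language (`|x| ≥ 1`). [folklore] -/
theorem inst_mem_G2_iff (x : List Bool) (t s : ℕ) (hn : 1 ≤ x.length) : NWPar.inst x t s ∈ G2 ↔ 2 ^ x.length ≤ t := by
  change g2F (NWPar.inst x t s) = [true] ↔ _; rw [g2F_inst, ← le_log_iff hn]; simp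

/-- **The promise problem of the test**: yes — main regime and every NW output avoids the slice; no — main
regime and the outputs hit the slice with probability `≥ 1/6`. [cite: Hirahara2018, Thm. 4.21 (proof)] -/
def Qtest : PromiseProblem :=
  ⟨{w | ∃ (x : List Bool) (t s : ℕ), w = NWPar.inst x t s ∧ S.N0 ≤ x.length ∧ s < x.length + S.cP ∧ t < 2 ^ x.length ∧
      ∀ z : List Bool, z.length = S.cfg.dOf x s → boolPair (NWSamp.yOf S.cfg x s z) (ones (S.cfg.t1Of x.length t)) ∉ S.TL},
   {w | ∃ (x : List Bool) (t s : ℕ), w = NWPar.inst x t s ∧ S.N0 ≤ x.length ∧ s < x.length + S.cP ∧ t < 2 ^ x.length ∧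
      1 / 6 ≤ uniformProb (S.cfg.dOf x s) {z | boolPair (NWSamp.yOf S.cfg x s z) (ones (S.cfg.t1Of x.length t)) ∈ S.TL}}⟩

/-- `inst` is injective. [folklore] -/
theorem inst_inj {x x' : List Bool} {t t' s s' : ℕ} (h : NWPar.inst x t s = NWPar.inst x' t' s') : x = x' ∧ t = t' ∧ s = s' := by
  rw [NWPar.inst_eq, NWPar.inst_eq] at h
  have h1 := boolPair_injective (a₁ := (x, _)) (a₂ := (x', _)) h
  simp only [Prod.mk.injEq] at h1
  obtain ⟨rfl, h2⟩ := h1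
  have h3 := boolPair_injective (a₁ := (unaryEncodeNat t, _)) (a₂ := (unaryEncodeNat t', _)) h2
  simp only [Prod.mk.injEq] at h3
  exact ⟨rfl, by simpa using congr_arg unaryDecodeNat h3.1, by simpa using congr_arg unaryDecodeNat h3.2⟩

/-- Instances with `|x| ≥ N0` and `s < |x| + cP` are in the main regime. [folklore] -/
theorem N0_main {x : List Bool} {s : ℕ} (hn : S.N0 ≤ x.length) (hs : s < x.length + S.cP) : S.Main x s :=
  ⟨by have : S.N0 = 6 * S.K' + S.A + S.B + S.cP + 4 := rfl; omega, hs⟩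

/-- `7 d ≤ 7 |inst|^D` (the coins of the test fit a polynomial in the instance length). [folklore] -/
theorem seven_dOf_le {x : List Bool} {s : ℕ} (h : S.Main x s) (t : ℕ) : 7 * S.cfg.dOf x s ≤ (7 * X ^ S.D : Polynomial ℕ).eval (NWPar.inst x t s).length := by
  have hd : S.cfg.dOf x s ≤ S.Bn x.length := by have := S.mOf_le_Bn h; rw [mOf_eq, dOf_eq] at *; omega
  have hlen : x.length + 2 ≤ (NWPar.inst x t s).length := by simp only [NWPar.inst, length_boolPair, List.length_replicate]; omega
  simp only [eval_mul, eval_pow, eval_X, eval_ofNat]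
  exact Nat.mul_le_mul_left 7 (hd.trans (Nat.pow_le_pow_left hlen _))

/-- **The test puts `Qtest` in `PromiseBPP'`.** [cite: Hirahara2018, Thm. 4.21 (proof)] [cite: Goldreich2006, Def. 1.2] -/
theorem Qtest_mem_PromiseBPP' : S.Qtest ∈ PromiseBPP' := by
  refine ⟨NWSamp.lang S.cfg S.TL, NWSamp.lang_mem_P S.henc S.hTL, 7 * X ^ S.D, ?_, ?_⟩
  · rintro w ⟨x, t, s, rfl, hn, hs, -, havoid⟩
    rw [NWSamp.prob_yes S.cfg S.TL (S.hR x.length t) (S.seven_dOf_le (S.N0_main hn hs) t) havoid]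
    norm_num
  · rintro w ⟨x, t, s, rfl, hn, hs, -, hhit⟩
    exact NWSamp.prob_no S.cfg S.TL (S.hR x.length t) (S.seven_dOf_le (S.N0_main hn hs) t) hhit

/-- **`K^{τ(n,t)}(x) ≤ n + cP`** (the printing bound at the budget `τ ≥ pP(n)`). [cite: LiuPass2020, §2.2 (Fact 2.2)] -/
theorem ktAt_τ_le (x : List Bool) (t : ℕ) : S.U.ktAt (S.τ x.length t) x ≤ (x.length + S.cP : ℕ) :=
  (S.U.ktAt_anti (S.le_τ x.length t).2.1 x).trans (S.hprint x)

/-- **`Gap_{σ,τ}MINKT ∈ Promise-P`** for the parameters of the setup, given `Promise-BPP ⊆ Promise-P`.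
[cite: Hirahara2018, Cor. 4.23] [cite: Hirahara2018, Thm. 4.21 (proof)] -/
theorem gapMINKT_mem_PromiseP (hPP : PromiseBPP' ⊆ PromiseP) : S.U.gapMINKT S.σ S.τ ∈ PromiseP := by
  classical
  obtain ⟨LQ, hLQ, hyesQ, hnoQ⟩ := hPP S.Qtest_mem_PromiseBPP'
  refine ⟨S.G1 ⊔ ((G2 ⊓ NWBrute.lang S.U S.cP) ⊔ (G2ᶜ ⊓ LQ)),
    union_mem_P S.G1_mem_P (union_mem_P (inter_mem_P G2_mem_P (NWBrute.lang_mem_P S.U S.cP)) (inter_mem_P (compl_mem_P_iff.2 G2_mem_P) hLQ)), ?_, ?_⟩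
  · -- yes-instances
    rintro w ⟨x, t, s, rfl, hK⟩
    rw [← NWPar.inst_eq]
    by_cases g1 : x.length < S.N0 ∨ x.length + S.cP ≤ s
    · exact Or.inl ((S.inst_mem_G1_iff x t s).2 g1)
    · have hn : S.N0 ≤ x.length := by omega
      have hs : s < x.length + S.cP := by omega
      have hn1 : 1 ≤ x.length := by have : S.N0 = 6 * S.K' + S.A + S.B + S.cP + 4 := rfl; omega
      by_cases g2 : 2 ^ x.length ≤ t
      · refine Or.inr (Or.inl ⟨(inst_mem_G2_iff x t s hn1).2 g2, (NWBrute.inst_mem_lang_iff S.U S.cP g2).2 ?_⟩)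
        obtain ⟨prog, hrun, hlt⟩ := S.U.exists_run_eq_of_ktAt_lt (m := ((s + 1 : ℕ) : ℕ∞)) (lt_of_le_of_lt hK (by exact_mod_cast Nat.lt_succ_self s))
        exact ⟨prog, by rw [min_eq_left (by omega)]; exact Nat.lt_succ_iff.1 (Nat.cast_lt.1 hlt), hrun⟩
      · rw [not_le] at g2
        refine Or.inr (Or.inr ⟨fun hG2 => absurd ((inst_mem_G2_iff x t s hn1).1 hG2) (not_le.2 g2), hyesQ ?_⟩)
        exact ⟨x, t, s, rfl, hn, hs, g2, S.yes_avoid (S.N0_main hn hs) g2 hK⟩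
  · -- no-instances
    intro w hw
    obtain ⟨x, t, s, rfl, hK⟩ := hw
    rw [← NWPar.inst_eq]
    have hprint := S.ktAt_τ_le x t
    have hσs : s + S.cσ ≤ S.σ x.length s := by rw [σ]; nlinarith [Nat.zero_le (Nat.log 2 x.length * Nat.sqrt s + Nat.log 2 x.length ^ 2)]
    have hcσ : S.N0 + S.cP ≤ S.cσ := by rw [show S.cσ = 4 * S.K₂ + 10 * S.lam + S.K₃ + S.N0 + S.cP from rfl]; omega
    -- the trivial regimes are impossible for no-instances
    have hn : S.N0 ≤ x.length := by
      by_contra hlt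
      have : S.U.ktAt (S.τ x.length t) x ≤ (S.σ x.length s : ℕ∞) := hprint.trans (by exact_mod_cast (by omega))
      exact absurd hK (not_lt.2 this)
    have hs : s < x.length + S.cP := by
      by_contra hle
      have : S.U.ktAt (S.τ x.length t) x ≤ (S.σ x.length s : ℕ∞) := hprint.trans (by exact_mod_cast (by omega))
      exact absurd hK (not_lt.2 this)
    have hn1 : 1 ≤ x.length := by have : S.N0 = 6 * S.K' + S.A + S.B + S.cP + 4 := rfl; omega
    rintro (h1 | ⟨h2, hbf⟩ | ⟨h2, hQ⟩)
    · rcases (S.inst_mem_G1_iff x t s).1 h1 with h | h <;> omega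
    · have g2 := (inst_mem_G2_iff x t s hn1).1 h2
      obtain ⟨prog, hlen, hrun⟩ := (NWBrute.inst_mem_lang_iff S.U S.cP g2).1 hbf
      have h1 : S.U.ktAt (S.τ x.length t) x ≤ (s : ℕ∞) :=
        (S.U.ktAt_anti (S.le_τ x.length t).1 x).trans ((S.U.ktAt_le_length hrun).trans (by exact_mod_cast hlen.trans (min_le_left _ _)))
      exact absurd hK (not_lt.2 (h1.trans (by exact_mod_cast (S.le_σ x.length s).1)))
    · have g2 : t < 2 ^ x.length := by
        by_contra hge; rw [not_lt] at hge; exact h2 ((inst_mem_G2_iff x t s hn1).2 hge)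
      exact hnoQ ⟨x, t, s, rfl, hn, hs, g2, S.no_hits (S.N0_main hn hs) hn g2 hK⟩ hQ

end Assembly

end Setup₂

end GapNW

/-! ### Cor. 4.23 from Buhrman–Fortnow–Pavan and a polynomial-time list-decodable code -/

/-- **Hirahara 2018, Cor. 4.23, from BFP (Thm. 3.1) and a polynomial-time list-decodable binary code (Thm. 4.7).**
If `DistNP ⊆ AvgP ⟹ Promise-BPP = Promise-P` (the named fact `BuhrmanFortnowPavan2004_PromiseBPP'_subset_PromiseP`)
and there is a code `Enc_{n,1/e} : {0,1}ⁿ → {0,1}^{2^ℓ}`, `ℓ ≤ c (log₂(n+e) + 1)`, computable in polynomial time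
(`enc ⟨1ᵉ, x⟩`), together with a polynomial-time decoder `dec ⟨1ᵉ, ⟨1ⁿ, r⟩⟩` whose output, read by `nthF`, lists
`x` within its first `p(n + e) + 1` entries whenever `r` agrees with `Enc(x)` on at least a `1/2 + 1/e` fraction of the
positions (Thm. 4.7: "`Enc` and `Dec` can be computed in time `poly(n, 1/ε)` … if `dist(Enc(x), r) ≤ 1/2 − ε` then
`x ∈ Dec(r)`", `L = poly(1/ε)`), then `Hirahara2018_gapMINKT_mem_PromiseP` holds: for every efficient universal
machine, `DistNP ⊆ AvgP` puts `Gap_{σ,τ}MINKT` in `Promise-P` for some `σ(n,s) = s + O((log n)√s + (log n)²)` and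
polynomial `τ`. [cite: Hirahara2018, Cor. 4.23] [cite: Hirahara2018, Thm. 4.7] [cite: BuhrmanFortnowPavan2004, Thm. 3.1] -/
theorem Hirahara2018_gapMINKT_mem_PromiseP_of_code (hBPP : BuhrmanFortnowPavan2004_PromiseBPP'_subset_PromiseP)
    (hcode : ∃ (enc dec : List Bool → List Bool) (ell : ℕ → ℕ → ℕ) (cL : ℕ) (pL : Polynomial ℕ),
      enc ∈ FP ∧ dec ∈ FP ∧ (∀ n e, ell n e ≤ cL * (Nat.log 2 (n + e) + 1)) ∧
      (∀ (n e : ℕ) (x : List Bool), x.length = n → (enc (boolPair (ones e) x)).length = 2 ^ ell n e) ∧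
      (∀ (n e : ℕ) (x r : List Bool), x.length = n → 1 ≤ e → r.length = 2 ^ ell n e →
        (e + 2) * 2 ^ ell n e ≤ 2 * e * NWStr.agreeCount r (enc (boolPair (ones e) x)) →
        ∃ i ≤ pL.eval (n + e), nthF i (dec (boolPair (ones e) (boolPair (ones n) r))) = x)) :
    Hirahara2018_gapMINKT_mem_PromiseP := by
  intro U hD
  obtain ⟨TL, hTL, n₀, hT⟩ := exists_dense_randomStrings_mem_P_of_DistNP Hirahara2018_MINKTr_DKT_mem_AvgDeltaP_holds
    Hirahara2018_dense_randomStrings_of_AvgDeltaP_holds U hD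
  obtain ⟨enc, dec, ell, cL, pL, henc, hdec, hell, hlen, hdecode⟩ := hcode
  obtain ⟨eL, -, heL⟩ := UHSParam.exists_pow_bound pL
  -- the printing bound, uniformly in `n`, from the identity machine
  obtain ⟨pid, Mid, hMid⟩ := (PolyTimeComputable.id _ : (id : List Bool → List Bool) ∈ FP)
  obtain ⟨eid, psim, hsim⟩ := U.exists_ktAt_le_of_outputsWithin Mid
  obtain ⟨cY, qY, hY⟩ := NWOut.exists_ktAt_nwOut_le U henc
  let S₁ : GapNW.Setup :=
    { U := U, TL := TL, hTL := hTL, n₀ := n₀, hT := hT, enc := enc, dec := dec, ell := ell, cL := cL, pL := pL, henc := henc, hdec := hdec,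
      hell := hell, hlen := hlen, hdecode := hdecode, eL := eL, heL := heL, cP := 2 * eid.length + 2, pP := psim.comp pid,
      hprint := fun x => by
        have h := hsim x _ _ (hMid x)
        rw [Polynomial.eval_comp]
        exact h.trans_eq (by simp),
      cY := cY, qY := qY, hY := hY }
  obtain ⟨cN, qN, hN⟩ := NWRec.exists_ktAt_le U hdec hTL S₁.cfg.qY S₁.cfg.PY
  let S : GapNW.Setup₂ := { S₁ with cN := cN, qN := qN, hN := hN }
  exact ⟨S.σ, S.τ, S.cσ, S.pτ, fun n s => S.le_σ n s, fun n t => ⟨(S.le_τ n t).1, le_rfl⟩, S.gapMINKT_mem_PromiseP (hBPP hD)⟩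

end Literature.Computability.MetaComplexity

end
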